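import Summits.QuantumFields.YangMills.Theorems.BalabanLadderIRPinnedExitCofinal
import Summits.QuantumFields.YangMills.Theorems.BalabanLadderIRTwistCostOfPurity
import Summits.QuantumFields.YangMills.Theorems.BalabanLadderIRColdPurityDobrushinCorner
import HarnessLib

/-!
# Line «deconfinement-ruler» (crux `IRcof`, stmt-QuantumFields-26930) — two helpers as tree theorems:
# (CU) IS NECESSARY for PXcof (S1-necessity), and the Dobrushin-door rung of (G)

Helper for `Summit.QuantumFields.YangMills.Theses.BalabanLadder.IRcof` (stmt-QuantumFields-26930), wave-2 line «deconfinement-ruler»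
(ideator ym-ir-idea-21 g0, lens `barrier`; workfile `Cruxes/IRcof/Lines/deconfinement_ruler.lean` 095381460304, card
`Cruxes/IRcof/Lines/deconfinement-ruler.md`; critic ym-ir-crit-3 g3 2026-08-28T17:20:39Z PASS-WITH-PRICE: «S1 necessity + Dobrushin rung are
landable»; director-ym №34 17:27:22Z: helpers keyed to pool-p3, row 42).  DEF-FREE: the line's predicates are SPELLED OUT (`MarginConfinedAt ρ β L η`
= «every central temporal twist `z` of the thick box `L³ × ⌊L/4⌋` costs at most the fraction `η`:
`1 − Z^{(z)}(L,L,L,⌊L/4⌋)/Z(L,L,L,⌊L/4⌋) ≤ η`»; PXcof(θ) = the slot body `PinnedCofinalBill.PinnedExitsCofinalAt θ`, as in the landed kernel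
`PinnedExitCofinal.ircofSC_of_pinnedExitsCofinal_le`); the workfile's `pinnedConfinedCofinal_of_pxcof` ∕ `stubCU_of_pxcof24` ∕
`confinedToPure_rung_dobrushin` are these theorems after `unfold PinnedConfinedCofinal MarginConfinedAt PinnedExitsCofinalAt`.

* `pinnedConfinedCofinal_of_pxcof` — **(CU) is NECESSARY**: PXcof(θ) ⟹ (CU)(2θ): at PXcof's own pinned `θ`-pure box (asked beyond `max β₁ 0`)
  every central temporal twist costs at most `2θ`, by S1 = `TwistCost.half_twist_cost_le_coldDefect` («half the twist cost is below the purity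
  defect», p613382-family, `Theorems/BalabanLadderIRTwistCostOfPurity.lean`).  `pinnedConfinedCofinal_twelfth_of_pxcof24`: the registered
  instance `1/12 = 2·(1/24)`.
* `coldDefect_mul_le_of_dobrushin` — **the RUNG of (G) at the Dobrushin door, margin hypothesis NOT NEEDED**: for every `θ > 0` ONE group-free
  `κ ≥ 1` with `coldDefect r.ρ β (κ·L) ≤ θ` for every compact metrisable `G`, every `r`, every `0 ≤ β ≤ 1/(216 N)`, every `L ≥ 8`
  (`ColdPurityDobrushin.coldExitAt_corner_of_dobrushinTV`); `confinedToPure_rung_dobrushin` — the same with the (idle) margin hypothesis in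
  the binder list, VERBATIM the workfile's rung with `MarginConfinedAt` spelled out.

HONEST FRAMING: (CU)-necessity is bookkeeping over the landed S1; the rung is a strong-coupling FORMAT fact (inside the Dobrushin door every long
box is pure), group-blind, width toward PXcof ∕ `IRcof` ∕ `IR` 0; the stubs (CU), (G), (CF), N_cof of the line are untouched; the Yang–Mills mass
gap (Clay) is NOT proved; R4 closes only the conditional finite-𝕋⁴ rung `BalabanLadder.UV`.
-/

set_option autoImplicit false

noncomputable section

open Filter Topology MeasureTheory
open Literature.MathematicalPhysics.QuantumFieldTheory Literature.MathematicalPhysics.QuantumLattice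
open Summit.QuantumFields.YangMills.Cruxes.OSLegsFromFemtoAndGap.DlrCollarTransfer (LowerBounds)
open Summit.QuantumFields.YangMills.Cruxes.IR.ColdPurityBridge (coldDefect)
open Summit.QuantumFields.YangMills.Cruxes.IR.TwistCost (half_twist_cost_le_coldDefect)
open Summit.QuantumFields.YangMills.Cruxes.IR.ColdPurityDobrushin (coldExitAt_corner_of_dobrushinTV)

namespace Summit.QuantumFields.YangMills.Cruxes.IRcof.DeconfinementRuler

/-! ## §1 (CU) is necessary for PXcof -/

/-- **(CU) IS NECESSARY: PXcof(θ) ⟹ PinnedConfinedCofinal(2θ)** — both spelled out.  Hypothesis = the slot body PXcof(θ) (a pinned `θ`-pure cold box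
`L³ × ⌊L/4⌋` at cofinally many couplings under the floor `LowerBounds`); conclusion = the same pinned box is `2θ`-MARGIN-CONFINED: every central
temporal twist `z` costs at most the fraction `2θ` of `Z(L,L,L,⌊L/4⌋)`.  Proof: S1 `half_twist_cost_le_coldDefect` at PXcof's own box, asked beyond
`max β₁ 0` so that `β ≥ 0`. -/
theorem pinnedConfinedCofinal_of_pxcof {θ : ℝ}
    (hP : ∀ (G : Type) [Group G] [TopologicalSpace G] [IsTopologicalGroup G] [CompactSpace G],
      IsCompactSimpleLieGroup G → SimplyConnectedSpace G →
      letI : MeasurableSpace G := borel G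
      haveI : BorelSpace G := ⟨rfl⟩
      ∀ (r : LatticeRep G) (a : ℝ → ℝ), (∀ β, 0 < a β) → Tendsto a atTop (𝓝 0) → LowerBounds G r a →
        ∃ T : ℝ, ∀ β₁ : ℝ, ∃ β : ℝ, β₁ ≤ β ∧ ∃ L : ℕ, 8 ≤ L ∧ a β * (L : ℝ) ≤ T ∧ coldDefect r.ρ β L ≤ θ) :
    ∀ (G : Type) [Group G] [TopologicalSpace G] [IsTopologicalGroup G] [CompactSpace G],
      IsCompactSimpleLieGroup G → SimplyConnectedSpace G →
      letI : MeasurableSpace G := borel G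
      haveI : BorelSpace G := ⟨rfl⟩
      ∀ (r : LatticeRep G) (a : ℝ → ℝ), (∀ β, 0 < a β) → Tendsto a atTop (𝓝 0) → LowerBounds G r a →
        ∃ T : ℝ, ∀ β₁ : ℝ, ∃ β : ℝ, β₁ ≤ β ∧ ∃ L : ℕ, 8 ≤ L ∧ a β * (L : ℝ) ≤ T ∧
          ∀ z : Fin 4 → G, (∀ μ, z μ ∈ Subgroup.center G) →
            1 - wilsonFinTorusTwistedPartition r.ρ β z L L L (L / 4) / wilsonFinTorusPartition r.ρ β L L L (L / 4) ≤ 2 * θ := by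
  intro G _ _ _ _ hGs hsc
  letI : MeasurableSpace G := borel G
  haveI : BorelSpace G := ⟨rfl⟩
  intro r a ha ha0 hlb
  haveI : SecondCountableTopology G :=
    (r.continuous.isClosedEmbedding r.injective).isEmbedding.secondCountableTopology
  obtain ⟨T, hcof⟩ := hP G hGs hsc r a ha ha0 hlb
  refine ⟨T, fun β₁ => ?_⟩
  obtain ⟨β, hβ, L, hL, hpin, hδ⟩ := hcof (max β₁ 0)
  refine ⟨β, (le_max_left _ _).trans hβ, L, hL, hpin, fun z hz => ?_⟩
  have h := (half_twist_cost_le_coldDefect r.continuous r.mem_unitary ((le_max_right _ _).trans hβ) hL hz).1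
  linarith

/-- **The registered instance: PXcof(1∕24) ⟹ (CU)(1∕12)** (`1/12 = 2·(1/24)`), the workfile's `stubCU_of_pxcof24` spelled out. -/
theorem pinnedConfinedCofinal_twelfth_of_pxcof24
    (hP : ∀ (G : Type) [Group G] [TopologicalSpace G] [IsTopologicalGroup G] [CompactSpace G],
      IsCompactSimpleLieGroup G → SimplyConnectedSpace G →
      letI : MeasurableSpace G := borel G
      haveI : BorelSpace G := ⟨rfl⟩
      ∀ (r : LatticeRep G) (a : ℝ → ℝ), (∀ β, 0 < a β) → Tendsto a atTop (𝓝 0) → LowerBounds G r a →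
        ∃ T : ℝ, ∀ β₁ : ℝ, ∃ β : ℝ, β₁ ≤ β ∧ ∃ L : ℕ, 8 ≤ L ∧ a β * (L : ℝ) ≤ T ∧ coldDefect r.ρ β L ≤ (1 / 24 : ℝ)) :
    ∀ (G : Type) [Group G] [TopologicalSpace G] [IsTopologicalGroup G] [CompactSpace G],
      IsCompactSimpleLieGroup G → SimplyConnectedSpace G →
      letI : MeasurableSpace G := borel G
      haveI : BorelSpace G := ⟨rfl⟩
      ∀ (r : LatticeRep G) (a : ℝ → ℝ), (∀ β, 0 < a β) → Tendsto a atTop (𝓝 0) → LowerBounds G r a →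
        ∃ T : ℝ, ∀ β₁ : ℝ, ∃ β : ℝ, β₁ ≤ β ∧ ∃ L : ℕ, 8 ≤ L ∧ a β * (L : ℝ) ≤ T ∧
          ∀ z : Fin 4 → G, (∀ μ, z μ ∈ Subgroup.center G) →
            1 - wilsonFinTorusTwistedPartition r.ρ β z L L L (L / 4) / wilsonFinTorusPartition r.ρ β L L L (L / 4) ≤ (1 / 12 : ℝ) := by
  intro G _ _ _ _ hGs hsc
  letI : MeasurableSpace G := borel G
  haveI : BorelSpace G := ⟨rfl⟩
  intro r a ha ha0 hlb
  obtain ⟨T, hcof⟩ := pinnedConfinedCofinal_of_pxcof hP G hGs hsc r a ha ha0 hlb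
  refine ⟨T, fun β₁ => ?_⟩
  obtain ⟨β, hβ, L, hL, hpin, hz⟩ := hcof β₁
  refine ⟨β, hβ, L, hL, hpin, fun z hzc => ?_⟩
  have h := hz z hzc
  linarith

/-! ## §2 The rung of (G) at the Dobrushin door -/

/-- **The rung, margin-free: inside the Dobrushin door every `κ`-fold box is `θ`-pure, ONE group-free `κ ≥ 1`.**  For every `θ > 0` there is
`κ ≥ 1` with `coldDefect r.ρ β (κ·L) ≤ θ` for every compact `G`, every lattice representation `r`, every `0 ≤ β` with `216·N·β ≤ 1` and every
`L ≥ 8` (indeed every `L ≥ 1`), from the landed corner `coldExitAt_corner_of_dobrushinTV` (`κ := max L₀ 1`). -/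
theorem coldDefect_mul_le_of_dobrushin {θ : ℝ} (hθ : 0 < θ) :
    ∃ κ : ℕ, 1 ≤ κ ∧ ∀ (G : Type) [Group G] [TopologicalSpace G] [IsTopologicalGroup G] [CompactSpace G]
      [MeasurableSpace G] [BorelSpace G] (r : LatticeRep G) (β : ℝ), 0 ≤ β → 216 * (r.N : ℝ) * β ≤ 1 →
      ∀ L : ℕ, 1 ≤ L → coldDefect r.ρ β (κ * L) ≤ θ := by
  obtain ⟨L₀, hL₀⟩ := coldExitAt_corner_of_dobrushinTV hθ
  refine ⟨max L₀ 1, le_max_right _ _, fun G _ _ _ _ _ _ r β h0 hβ L hL => ?_⟩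
  refine hL₀ G r β h0 hβ (max L₀ 1 * L) ?_
  calc L₀ ≤ max L₀ 1 := le_max_left _ _
    _ = max L₀ 1 * 1 := (mul_one _).symm
    _ ≤ max L₀ 1 * L := Nat.mul_le_mul_left _ hL

/-- **The workfile's rung `confinedToPure_rung_dobrushin`, VERBATIM with `MarginConfinedAt` spelled out** (the margin hypothesis is idle: inside the
door every long box is pure): for every `θ > 0` ONE group-free `κ ≥ 1` such that for every compact `G`, `r`, `0 ≤ β ≤ 1/(216 N)`, `L ≥ 8` and margin `η`,
«`L³ × ⌊L/4⌋` is `η`-margin-confined» ⟹ `coldDefect r.ρ β (κL) ≤ θ`. -/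
theorem confinedToPure_rung_dobrushin {θ : ℝ} (hθ : 0 < θ) :
    ∃ κ : ℕ, 1 ≤ κ ∧ ∀ (G : Type) [Group G] [TopologicalSpace G] [IsTopologicalGroup G] [CompactSpace G]
      [MeasurableSpace G] [BorelSpace G] (r : LatticeRep G) (β : ℝ), 0 ≤ β → 216 * (r.N : ℝ) * β ≤ 1 →
      ∀ L : ℕ, 8 ≤ L → ∀ η : ℝ,
        (∀ z : Fin 4 → G, (∀ μ, z μ ∈ Subgroup.center G) →
          1 - wilsonFinTorusTwistedPartition r.ρ β z L L L (L / 4) / wilsonFinTorusPartition r.ρ β L L L (L / 4) ≤ η) →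
        coldDefect r.ρ β (κ * L) ≤ θ := by
  obtain ⟨κ, hκ, h⟩ := coldDefect_mul_le_of_dobrushin hθ
  exact ⟨κ, hκ, fun G _ _ _ _ _ _ r β h0 hβ L hL _ _ => h G r β h0 hβ L (by omega)⟩

end Summit.QuantumFields.YangMills.Cruxes.IRcof.DeconfinementRuler

end
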